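import Summits.ValiantsHypothesis.ValiantsHypothesis.Theorems.KPlusLogSqLawPiecewiseAffineDefs

/-!
# Route «KPlusLogSqLaw» — piecewise-affine bookkeeping: sums, maxima and transversal zeros

HONEST FRAMING.  Toolkit for the divide-and-conquer layer of the static-path tropical count (val-sym-lift-p4 g6
`HOME/val-sym-lift-p4/STATIC-PATH-NLOGN.md` §5–6; kernel fold lemma `…Theorems.KPlusLogSqLaw.StaticPathFold`, seat val-sym-lift-p3 g6,
2026-08-27), a helper line toward the crux `WeakLifting` (item `stmt-ValiantsHypothesis-19561`, route `KPlusLogSqLaw`) on its witness-plan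
stub `stub_tridiagonalSectorB`.  With the kink-set certificates `PA g K` of `KPlusLogSqLawPiecewiseAffineDefs.lean`: affine functions are
`PA _ ∅`; certificates are monotone in `K`, add under sums/negations (`PA.add`, `PA.neg`, `PA.sub`); and — the one non-trivial rule, the
«junction law» of the paper's §6 in abstract form — a MAXIMUM of two certified functions is certified by the two kink sets together with
the transversal zeros of the difference, whose number is at most ONE PLUS THE SIZE OF ANY CERTIFICATE OF THE DIFFERENCE
(`ncard_crossSet_le`, `pa_max`): this is how the breakpoints of `max (A + B) (A' + B')` are charged to those of `A, B, A', B'` and to the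
pieces of the trains `A − A'`, `B' − B`.  Statements about real functions only; nothing here bears on `WeakLifting`, `TropicalB`,
`KPlusLogSqLaw`, `MatrixDescartes` (stmt-ValiantsHypothesis-18050) or `VP ≠ VNP`.
-/

set_option linter.dupNamespace false
set_option autoImplicit false

namespace Summit.ValiantsHypothesis.ValiantsHypothesis.Theorems.KPlusLogSqLaw

open Set

namespace PiecewiseAffine

/-! ## 1. Basic certificates -/

/-- freeness is monotone under shrinking the set. [folklore] -/
theorem Free.mono {K K' : Finset ℝ} (h : K ⊆ K') {x y : ℝ} (hf : Free K' x y) : Free K x y :=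
  fun k hk => hf k (h hk)

/-- freeness is monotone under shrinking the interval. [folklore] -/
theorem Free.sub {K : Finset ℝ} {x y x' y' : ℝ} (hf : Free K x y) (hx : x ≤ x') (hy : y' ≤ y) : Free K x' y' :=
  fun k hk => (hf k hk).imp (fun h => h.trans hx) (fun h => hy.trans h)

/-- certificates are monotone in the kink set. [folklore] -/
theorem PA.mono {g : ℝ → ℝ} {K K' : Finset ℝ} (h : PA g K) (hK : K ⊆ K') : PA g K' :=
  fun x y hxy hf => h x y hxy (hf.mono hK)

/-- an affine function is certified by the empty set. [folklore] -/
theorem pa_affine (p q : ℝ) : PA (fun τ => p * τ + q) ∅ :=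
  fun _ _ _ _ => ⟨p, q, fun _ _ => rfl⟩

/-- a constant function is certified by the empty set. [folklore] -/
theorem pa_const (c : ℝ) : PA (fun _ => c) ∅ :=
  fun _ _ _ _ => ⟨0, c, fun _ _ => by ring⟩

/-- sums: the union of the certificates. [folklore] -/
theorem PA.add {g₁ g₂ : ℝ → ℝ} {K₁ K₂ : Finset ℝ} (h₁ : PA g₁ K₁) (h₂ : PA g₂ K₂) :
    PA (fun τ => g₁ τ + g₂ τ) (K₁ ∪ K₂) := by
  intro x y hxy hf
  obtain ⟨p₁, q₁, e₁⟩ := h₁ x y hxy (hf.mono Finset.subset_union_left)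
  obtain ⟨p₂, q₂, e₂⟩ := h₂ x y hxy (hf.mono Finset.subset_union_right)
  exact ⟨p₁ + p₂, q₁ + q₂, fun τ hτ => by show g₁ τ + g₂ τ = _; rw [e₁ τ hτ, e₂ τ hτ]; ring⟩

/-- negation keeps the certificate. [folklore] -/
theorem PA.neg {g : ℝ → ℝ} {K : Finset ℝ} (h : PA g K) : PA (fun τ => -g τ) K := by
  intro x y hxy hf
  obtain ⟨p, q, e⟩ := h x y hxy hf
  exact ⟨-p, -q, fun τ hτ => by show -g τ = _; rw [e τ hτ]; ring⟩

/-- differences: the union of the certificates. [folklore] -/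
theorem PA.sub {g₁ g₂ : ℝ → ℝ} {K₁ K₂ : Finset ℝ} (h₁ : PA g₁ K₁) (h₂ : PA g₂ K₂) :
    PA (fun τ => g₁ τ - g₂ τ) (K₁ ∪ K₂) := by
  have h := h₁.add h₂.neg
  intro x y hxy hf
  obtain ⟨p, q, e⟩ := h x y hxy hf
  exact ⟨p, q, fun τ hτ => by show g₁ τ - g₂ τ = _; rw [sub_eq_add_neg]; exact e τ hτ⟩

/-- a certified function is affine on every closed interval whose interior misses the certificate, in «congruence» form. [folklore] -/
theorem PA.congr {g g' : ℝ → ℝ} {K : Finset ℝ} (h : PA g K) (hg : ∀ τ, g' τ = g τ) : PA g' K := by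
  intro x y hxy hf
  obtain ⟨p, q, e⟩ := h x y hxy hf
  exact ⟨p, q, fun τ hτ => by rw [hg, e τ hτ]⟩

/-! ## 2. Transversal zeros -/

/-- two affine expressions that agree at two distinct points have the same slope. [folklore] -/
theorem slope_eq_of_eq_two {p q p' q' s t : ℝ} (hst : s ≠ t) (hs : p * s + q = p' * s + q') (ht : p * t + q = p' * t + q') :
    p = p' := by
  have h1 : (p - p') * (s - t) = 0 := by linarith
  rcases mul_eq_zero.mp h1 with h | h
  · linarith
  · exact absurd (sub_eq_zero.mp h) hst

/-- the «previous kink» of a real number: the largest element of `K` below it (or none). [folklore] -/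
noncomputable def prevKink (K : Finset ℝ) (θ : ℝ) : WithBot ℝ := (K.filter (· < θ)).max

/-- transversal zeros with the same previous kink coincide. [folklore] -/
theorem crossSet_injOn {h : ℝ → ℝ} {K : Finset ℝ} (hPA : PA h K) : InjOn (prevKink K) (crossSet h K) := by
  -- if θ₁ < θ₂ are transversal zeros with no kink in [θ₁, θ₂), one affine piece with nonzero slope carries both zeros
  have key : ∀ θ₁ ∈ crossSet h K, ∀ θ₂ ∈ crossSet h K, θ₁ < θ₂ → prevKink K θ₁ ≠ prevKink K θ₂ := by
    intro θ₁ h1 θ₂ h2 hlt heq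
    obtain ⟨hz₁, x₁, y₁, p₁, q₁, hx₁, hy₁, hf₁, hp₁, he₁⟩ := h1
    obtain ⟨hz₂, x₂, y₂, p₂, q₂, hx₂, hy₂, hf₂, hp₂, he₂⟩ := h2
    -- no point of `K` in `[θ₁, θ₂)`: such a point would lie below `θ₂` but not below `θ₁`
    have hnoK : ∀ k ∈ K, ¬ (θ₁ ≤ k ∧ k < θ₂) := by
      rintro k hk ⟨hk1, hk2⟩
      have hmem : k ∈ K.filter (· < θ₂) := Finset.mem_filter.mpr ⟨hk, hk2⟩
      have hle : (k : WithBot ℝ) ≤ prevKink K θ₂ := Finset.le_max hmem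
      rw [← heq] at hle
      -- every element of `K.filter (· < θ₁)` is `< θ₁ ≤ k`, so its max is `< k`
      have hlt' : prevKink K θ₁ < (k : WithBot ℝ) := by
        unfold prevKink
        rcases Finset.eq_empty_or_nonempty (K.filter (· < θ₁)) with he | hne
        · rw [he, Finset.max_empty]; exact WithBot.bot_lt_coe k
        · obtain ⟨m, hm⟩ := Finset.max_of_nonempty hne
          rw [hm]
          have hm' := Finset.mem_of_max hm
          have : m < θ₁ := (Finset.mem_filter.mp hm').2
          exact WithBot.coe_lt_coe.mpr (by linarith)
      exact absurd (lt_of_lt_of_le hlt' hle) (lt_irrefl _)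
    -- the interval `[x₁, y₂]` has `K`-free interior
    have hfree : Free K x₁ y₂ := by
      intro k hk
      rcases hf₁ k hk with h | h
      · exact Or.inl h
      · -- `k ≥ y₁ > θ₁`; if `k < y₂` then `k ∉ (x₂, y₂)` forces `k ≤ x₂ < θ₂`, so `θ₁ ≤ k < θ₂`: excluded
        rcases hf₂ k hk with h' | h'
        · exact absurd ⟨by linarith, by linarith⟩ (hnoK k hk)
        · exact Or.inr h'
    obtain ⟨p, q, he⟩ := hPA x₁ y₂ (by linarith) hfree
    -- on `[x₁, min y₁ y₂]` both `p₁ τ + q₁` and `p τ + q` describe `h`: equal slopes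
    have hmin : x₁ < min y₁ y₂ := lt_min (by linarith) (by linarith)
    have hs1 : p * x₁ + q = p₁ * x₁ + q₁ := by
      rw [← he x₁ ⟨le_rfl, by linarith⟩, he₁ x₁ ⟨le_rfl, by linarith⟩]
    have hs2 : p * min y₁ y₂ + q = p₁ * min y₁ y₂ + q₁ := by
      rw [← he (min y₁ y₂) ⟨hmin.le, min_le_right _ _⟩, he₁ (min y₁ y₂) ⟨hmin.le, min_le_left _ _⟩]
    have hp : p = p₁ := slope_eq_of_eq_two (ne_of_lt hmin) hs1 hs2
    -- two distinct zeros of `p τ + q` on `[x₁, y₂]` with `p ≠ 0`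
    have hz₁' : p * θ₁ + q = 0 := by rw [← he θ₁ ⟨hx₁.le, by linarith⟩]; exact hz₁
    have hz₂' : p * θ₂ + q = 0 := by rw [← he θ₂ ⟨by linarith, hy₂.le⟩]; exact hz₂
    have : p * (θ₂ - θ₁) = 0 := by linarith
    rcases mul_eq_zero.mp this with h0 | h0
    · exact hp₁ (hp ▸ h0)
    · linarith
  intro θ₁ h1 θ₂ h2 heq
  rcases lt_trichotomy θ₁ θ₂ with h | h | h
  · exact absurd heq (key θ₁ h1 θ₂ h2 h)
  · exact h
  · exact absurd heq.symm (key θ₂ h2 θ₁ h1 h)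

/-- the transversal zeros form a finite set of size at most `|K| + 1`. [folklore] -/
theorem finite_crossSet {h : ℝ → ℝ} {K : Finset ℝ} (hPA : PA h K) : (crossSet h K).Finite := by
  have hsub : MapsTo (prevKink K) (crossSet h K) (↑(insert ⊥ (K.image (fun k : ℝ => (k : WithBot ℝ))) : Finset (WithBot ℝ))) := by
    intro θ _
    unfold prevKink
    rcases Finset.eq_empty_or_nonempty (K.filter (· < θ)) with he | hne
    · rw [he, Finset.max_empty]; exact Finset.mem_coe.mpr (Finset.mem_insert_self _ _)
    · obtain ⟨m, hm⟩ := Finset.max_of_nonempty hne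
      rw [hm]
      have hm' := (Finset.mem_filter.mp (Finset.mem_of_max hm)).1
      exact Finset.mem_coe.mpr (Finset.mem_insert_of_mem (Finset.mem_image.mpr ⟨m, hm', rfl⟩))
  exact Set.Finite.of_injOn hsub (crossSet_injOn hPA) (Finset.finite_toSet _)

/-- **the number of transversal zeros is at most one plus the size of the certificate.** [folklore] -/
theorem ncard_crossSet_le {h : ℝ → ℝ} {K : Finset ℝ} (hPA : PA h K) : (crossSet h K).ncard ≤ K.card + 1 := by
  have hsub : MapsTo (prevKink K) (crossSet h K) (↑(insert ⊥ (K.image (fun k : ℝ => (k : WithBot ℝ))) : Finset (WithBot ℝ))) := by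
    intro θ _
    unfold prevKink
    rcases Finset.eq_empty_or_nonempty (K.filter (· < θ)) with he | hne
    · rw [he, Finset.max_empty]; exact Finset.mem_coe.mpr (Finset.mem_insert_self _ _)
    · obtain ⟨m, hm⟩ := Finset.max_of_nonempty hne
      rw [hm]
      have hm' := (Finset.mem_filter.mp (Finset.mem_of_max hm)).1
      exact Finset.mem_coe.mpr (Finset.mem_insert_of_mem (Finset.mem_image.mpr ⟨m, hm', rfl⟩))
  have h1 := Set.ncard_le_ncard_of_injOn (prevKink K) hsub (crossSet_injOn hPA) (Finset.finite_toSet _)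
  rw [Set.ncard_coe_finset] at h1
  refine h1.trans ?_
  refine (Finset.card_insert_le _ _).trans ?_
  exact Nat.succ_le_succ Finset.card_image_le

/-! ## 3. The junction law: maxima -/

/-- **maximum of two certified functions.**  If `g₁`, `g₂` are certified by `K₁`, `K₂` and their difference by `K`, then `max g₁ g₂` is
certified by `K₁ ∪ K₂ ∪ K` together with the transversal zeros of the difference (at most `|K| + 1` of them). [folklore] -/
theorem pa_max {g₁ g₂ : ℝ → ℝ} {K₁ K₂ K : Finset ℝ} (h₁ : PA g₁ K₁) (h₂ : PA g₂ K₂)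
    (hd : PA (fun τ => g₁ τ - g₂ τ) K) :
    PA (fun τ => max (g₁ τ) (g₂ τ)) (K₁ ∪ K₂ ∪ K ∪ (finite_crossSet hd).toFinset) := by
  intro x y hxy hf
  obtain ⟨p₁, q₁, e₁⟩ := h₁ x y hxy (hf.mono (by intro k hk; simp [hk]))
  obtain ⟨p₂, q₂, e₂⟩ := h₂ x y hxy (hf.mono (by intro k hk; simp [hk]))
  have hfK : Free K x y := hf.mono (by intro k hk; simp [hk])
  -- the difference is `p τ + q` on `[x, y]`
  set p := p₁ - p₂ with hp
  set q := q₁ - q₂ with hq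
  have hdiff : ∀ τ ∈ Icc x y, g₁ τ - g₂ τ = p * τ + q := fun τ hτ => by rw [e₁ τ hτ, e₂ τ hτ, hp, hq]; ring
  -- no transversal zero of the difference lies in `(x, y)`
  have hnoz : ∀ θ, x < θ → θ < y → p ≠ 0 → p * θ + q ≠ 0 := by
    intro θ hx hy hp0 hz
    have hθ : θ ∈ crossSet (fun τ => g₁ τ - g₂ τ) K :=
      ⟨by show g₁ θ - g₂ θ = 0; rw [hdiff θ ⟨hx.le, hy.le⟩]; exact hz, x, y, p, q, hx, hy, hfK, hp0, hdiff⟩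
    have hmem : θ ∈ (finite_crossSet hd).toFinset := (Set.Finite.mem_toFinset _).mpr hθ
    rcases hf θ (by simp [hmem]) with h | h
    · linarith
    · linarith
  -- hence the difference has a constant sign on `[x, y]`, and the max is one of the two affine pieces
  by_cases hcase : ∀ τ ∈ Icc x y, 0 ≤ p * τ + q
  · refine ⟨p₁, q₁, fun τ hτ => ?_⟩
    have := hcase τ hτ
    rw [← hdiff τ hτ] at this
    show max (g₁ τ) (g₂ τ) = _
    rw [max_eq_left (by linarith), e₁ τ hτ]
  · push Not at hcase
    obtain ⟨τ₀, hτ₀, hneg⟩ := hcase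
    -- then `p τ + q ≤ 0` on the whole interval: otherwise a sign change produces an interior zero with `p ≠ 0`
    have hle : ∀ τ ∈ Icc x y, p * τ + q ≤ 0 := by
      intro τ hτ
      by_contra hpos
      push Not at hpos
      have hp0 : p ≠ 0 := by
        intro h0; rw [h0] at hneg hpos; linarith
      -- the zero `θ = -q/p` lies strictly between `τ₀` and `τ`, hence in `(x, y)`
      have hzero : p * (-q / p) + q = 0 := by
        calc p * (-q / p) + q = -q / p * p + q := by ring
          _ = -q + q := by rw [div_mul_cancel₀ (-q) hp0]
          _ = 0 := by ring
      have hbetween : min τ₀ τ < -q / p ∧ -q / p < Max.max τ₀ τ := by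
        rcases lt_or_gt_of_ne hp0 with hpn | hpp
        · -- p < 0: the expression is decreasing; negative at τ₀, positive at τ ⇒ τ < -q/p < τ₀
          have h1 : τ < -q / p := by
            rw [lt_div_iff_of_neg hpn]; linarith
          have h2 : -q / p < τ₀ := by
            rw [div_lt_iff_of_neg hpn]; linarith
          exact ⟨lt_of_le_of_lt (min_le_right _ _) h1, lt_of_lt_of_le h2 (le_max_left _ _)⟩
        · have h1 : τ₀ < -q / p := by
            rw [lt_div_iff₀ hpp]; linarith
          have h2 : -q / p < τ := by
            rw [div_lt_iff₀ hpp]; linarith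
          exact ⟨lt_of_le_of_lt (min_le_left _ _) h1, lt_of_lt_of_le h2 (le_max_right _ _)⟩
      have hx' : x < -q / p := lt_of_le_of_lt (le_min hτ₀.1 hτ.1) hbetween.1
      have hy' : -q / p < y := lt_of_lt_of_le hbetween.2 (max_le hτ₀.2 hτ.2)
      exact hnoz _ hx' hy' hp0 hzero
    refine ⟨p₂, q₂, fun τ hτ => ?_⟩
    have := hle τ hτ
    rw [← hdiff τ hτ] at this
    show max (g₁ τ) (g₂ τ) = _
    rw [max_eq_right (by linarith), e₂ τ hτ]

/-- the size of the certificate produced by `pa_max`. [folklore] -/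
theorem card_max_cert_le {g₁ g₂ : ℝ → ℝ} {K₁ K₂ K : Finset ℝ} (hd : PA (fun τ => g₁ τ - g₂ τ) K) :
    (K₁ ∪ K₂ ∪ K ∪ (finite_crossSet hd).toFinset).card ≤ K₁.card + K₂.card + 2 * K.card + 1 := by
  have h1 : (finite_crossSet hd).toFinset.card ≤ K.card + 1 := by
    rw [← Set.ncard_eq_toFinset_card _ (finite_crossSet hd)]
    exact ncard_crossSet_le hd
  calc (K₁ ∪ K₂ ∪ K ∪ (finite_crossSet hd).toFinset).card
      ≤ (K₁ ∪ K₂ ∪ K).card + (finite_crossSet hd).toFinset.card := Finset.card_union_le _ _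
    _ ≤ ((K₁ ∪ K₂).card + K.card) + (K.card + 1) := Nat.add_le_add (Finset.card_union_le _ _) h1
    _ ≤ (K₁.card + K₂.card + K.card) + (K.card + 1) := by
        have := Finset.card_union_le K₁ K₂; omega
    _ = K₁.card + K₂.card + 2 * K.card + 1 := by ring

end PiecewiseAffine

end Summit.ValiantsHypothesis.ValiantsHypothesis.Theorems.KPlusLogSqLaw
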